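import Summits.ResolutionOfSingularities.ResolutionOfSingularities.Theorems.ExitCutKernels2
import Summits.ResolutionOfSingularities.ResolutionOfSingularities.Theorems.MaxContactCutCuspCut
import HarnessLib

/-!
# MaxContactCutExitCut — decomp-res node «ExitCut» (lens-2 g27, critic row 212 CLEARED · MAP +1 ONCE (port layer
1)), tree file 3/3 of the node

Content VERBATIM from the decomp-res lens-2 g27 node `HOME/decomp-res-lens-2/g27/ExitCut.lean` (pin a67800dc; no
carry, imports the landed g24 node + ForcedTowerClasses + Literature; ns `…Theses.ExitCut` ↦ `…Theorems.ExitCut`);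
HOME = run/shared/lean/pub/decomp-res; critic CRITIC-LEDGER row 212 CLEARED · MAP +1 ONCE (port layer 1):
`oneShotPort_holds : ∀ n, OneShotPort n` in kernel; landing orders LANDING NOTE :1437 + rider 11:18:17Z — provenance
and critic text in full in `ExitCutKernels`, the lens header verbatim in `ExitCutKernels2`.  `--kind proof
--supports stmt-ResolutionOfSingularities-29273`.

## This file

§K.6 `section Corollaries` — THE BY-NAME COROLLARIES through the LANDED consumers and `closes` (Theses cone; the
binders `hport : OneShotPort n` / `h1 : OrderOneContact` of the g9–g26 wirings REMOVED), in lens order: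
`genericRung_of_faceFormExit` · `genRungAt_of_faceFormExit` · `genRungAt_one_holds` · `lGenRungAt_one_holds` ·
`dGenRungAt_one_holds` · `pGenRungAt_one_holds` · `cuspGenericRung_of_ports` · `closes_of_engines`; the node's `closes` is
CITED from the landed `FaceCut.FaceX.closes` / `CuspCut.CuspX.closes` (same statement — gate dedup; note at the end
of the file).

[WRITER NOTE (decomp-res writer g13): file split only (tree files ≤ 400 lines); sections, section `variable`s /
`open`s and every declaration exactly as in the lens (namespace renamed Theses ↦ Theorems, the HOME-only
dupNamespace-linter line dropped; `noncomputable section` and the five file-level `open` lines replayed in every file).]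

(Sources: Hironaka1964 Ch. III §§1–3, §7; Giraud1975; CossartJannsenSaito2020 Ch. 2, Ch. 8–9; EGAIV4 §16–§17;
Matsumura1987 §28–§30; CossartPiltant2008 Prop. 4.2; BierstoneMilman1997 §3; Cutkosky2004 Ch. 6–7; Kollar2007 §3;
StacksProject 01WV / 0806 / 080A.)
-/

noncomputable section

open CategoryTheory AlgebraicGeometry IsLocalRing TopologicalSpace Topology
open Literature.AlgebraicGeometry.Resolution
open Summit.ResolutionOfSingularities.ResolutionOfSingularities.Theorems
open Summit.ResolutionOfSingularities.ResolutionOfSingularities.Theorems.WeakOrderReduction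
open Summit.ResolutionOfSingularities.ResolutionOfSingularities.Theorems.FaceFormCutClasses

namespace Summit.ResolutionOfSingularities.ResolutionOfSingularities.Theorems.ExitCut

section Corollaries

open Summit.ResolutionOfSingularities.ResolutionOfSingularities.Theorems.DeltaFaceCutClasses
open Summit.ResolutionOfSingularities.ResolutionOfSingularities.Theorems.RelativeDeltaCut
open Summit.ResolutionOfSingularities.ResolutionOfSingularities.Theorems.CurveLeafExit
open Summit.ResolutionOfSingularities.ResolutionOfSingularities.Theorems.PinchCut
open Summit.ResolutionOfSingularities.ResolutionOfSingularities.Theorems.JetCut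
open Summit.ResolutionOfSingularities.ResolutionOfSingularities.Theorems.PurityCut
open Summit.ResolutionOfSingularities.ResolutionOfSingularities.Theorems.SplitCut
open Summit.ResolutionOfSingularities.ResolutionOfSingularities.Theorems.CylinderCut
open Summit.ResolutionOfSingularities.ResolutionOfSingularities.Theorems.SpreadCut
open Summit.ResolutionOfSingularities.ResolutionOfSingularities.Theorems.CrossCut
open Summit.ResolutionOfSingularities.ResolutionOfSingularities.Theorems.DeepCrossCut
open Summit.ResolutionOfSingularities.ResolutionOfSingularities.Theorems.OddCrossCut
open Summit.ResolutionOfSingularities.ResolutionOfSingularities.Theorems.CuspCut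
open Summit.ResolutionOfSingularities.ResolutionOfSingularities.Theses

/-! ## §K.6  By-name corollaries through the LANDED consumers, and `closes` -/

/-- **COROLLARY (g9, by name).** `FaceFormCutClasses.GenericRung ⟸ FaceFormExit` ALONE: the binders
`hP : ∀ n ≥ 2, OneShotPort n` and `h1 : OrderOneContact` of the landed `genericRung_of_engine` are
discharged by the kernels. [folklore] -/
theorem genericRung_of_faceFormExit (hE : FaceFormExit) : FaceFormCutClasses.GenericRung :=
  genericRung_of_engine hE oneShotPort_holds' orderOneContact_holds

/-- **COROLLARY (g9, by name).** `GenRungAt n ⟸ FaceFormExit` for every `n ≥ 2`. [folklore] -/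
theorem genRungAt_of_faceFormExit (hE : FaceFormExit) {n : ℕ} (hn : 2 ≤ n) : GenRungAt n :=
  genRungAt_of_engine hE (oneShotPort_holds n) hn

/-- **COROLLARY.** `GenRungAt 1` unconditionally (landed `genRungAt_one`). [folklore] -/
theorem genRungAt_one_holds : GenRungAt 1 := genRungAt_one orderOneContact_holds

/-- **COROLLARY.** `LGenRungAt 1` unconditionally (landed `CurveLeafExit.lGenRungAt_one`). [folklore] -/
theorem lGenRungAt_one_holds : LGenRungAt 1 := lGenRungAt_one orderOneContact_holds

/-- **COROLLARY.** `DGenRungAt 1` unconditionally (landed `DeltaFaceCutKernels.dGenRungAt_one`). [folklore] -/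
theorem dGenRungAt_one_holds : DGenRungAt 1 := DeltaFaceCutKernels.dGenRungAt_one orderOneContact_holds

/-- **COROLLARY.** `PGenRungAt 1` unconditionally (landed `PinchCut.pGenRungAt_one`). [folklore] -/
theorem pGenRungAt_one_holds : PGenRungAt 1 := pGenRungAt_one orderOneContact_holds

/-- **COROLLARY (g25 wiring, by name, binder `h1` removed).** `CuspX.CuspGenericRung` from the engines and
the multi-unit port alone. [folklore] -/
theorem cuspGenericRung_of_ports (hV : VeryNearCutClasses.VeryNearExit) (hD : DeltaPackageExit)
    (hU : UniformCurvePackageExit) (hR : RelCurvePackageExit) (hN : NormalConeJumpExit)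
    (hM : MonomialPinchExit) (hC : FlatConeExit) (hGE : GrandExit) (hSE : SplitConeExit)
    (hJE : JetCylinderExit) (hX : MaxContactCut.MaxOrderThreefoldResolution) (hΓE : SpreadExit) (hXE : CrossExit)
    (hDXE : DeepCrossExit) (hNE : NodeExit) (hOXE : OddCrossExit) (hCuE : CuspExit) (hTaE : TameTwoExit)
    (hP : ∀ n : ℕ, 2 ≤ n → ComponentPackagePort n) : CuspX.CuspGenericRung :=
  CuspX.cuspGenericRung_of_ports hV hD hU hR hN hM hC hGE hSE hJE hX hΓE hXE hDXE hNE hOXE hCuE hTaE hP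
    orderOneContact_holds

/-- **`closes_of_engines` re-wired (binder `h1 : OrderOneContact` removed; 0-weight).** [folklore] -/
theorem closes_of_engines (hV : VeryNearCutClasses.VeryNearExit) (hD : DeltaPackageExit)
    (hU : UniformCurvePackageExit) (hR : RelCurvePackageExit) (hN : NormalConeJumpExit)
    (hM : MonomialPinchExit) (hC : FlatConeExit) (hGE : GrandExit) (hSE : SplitConeExit)
    (hJE : JetCylinderExit) (hX : MaxContactCut.MaxOrderThreefoldResolution) (hΓE : SpreadExit) (hXE : CrossExit)
    (hDXE : DeepCrossExit) (hNE : NodeExit) (hOXE : OddCrossExit) (hCuE : CuspExit) (hTaE : TameTwoExit)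
    (hP : ∀ n : ℕ, 2 ≤ n → ComponentPackagePort n) (hS : CuspX.CuspSpecialRung) : MaxContactCut.RungOne :=
  CuspX.closes_of_engines hV hD hU hR hN hM hC hGE hSE hJE hX hΓE hXE hDXE hNE hOXE hCuE hTaE hP
    orderOneContact_holds hS

/-! ### `closes` — NOT re-landed here (gate dedup: the statement is already a landed theorem)

The node's `theorem closes (hG : CuspX.CuspGenericRung) (hS : CuspX.CuspSpecialRung) : MaxContactCut.RungOne` (proof
`CuspX.closes hG hS`) has exactly the type of the LANDED `FaceCut.FaceX.closes` (`Theorems/MaxContactCutFaceCut.lean`) and of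
`CuspCut.CuspX.closes` (`Theorems/MaxContactCutCuspCut.lean`); the gate's dedup lint refuses a third copy, so the
column target BY NAME
is CITED from those declarations (located halves unchanged: `CuspX.CuspGenericRung` [DECIDED MOD the engines/ports
above, now with
`OneShotPort` discharged in kernel via `closes_of_engines`] and `CuspX.CuspSpecialRung` [UNDECIDED]). Writer g13. -/

end Corollaries

end Summit.ResolutionOfSingularities.ResolutionOfSingularities.Theorems.ExitCut
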